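import Mathlib
import Literature.MathematicalPhysics.QuantumFieldTheory.Dimock2011to13.QED3BlockingGeometry
import HarnessLib

/-!
# Dimock, *Quantum electrodynamics on the 3-torus II*, Appendix A.2 LEMMA 6 (214) — the EXPLICIT COMPOSITE of `k`
# gauge-covariant block averagings `Q_k(a_{k−1}, …, a_0)`: one average over the `L^k`-cube with the phase
# `exp(ie_k Σ_{j=0}^{k−1} (Q̃_ja_j)(Γ_{x_{j+1},x_j}))` accumulated along the chain of block centres `x = x_0, x_1, …, x_k = y` —
# PROVED (with its printed induction (215)–(217)), together with the gauge covariance of the composite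

statement-level skeleton of published theorems with citation tags; proofs where landed; nothing here is a claim about the Yang–Mills mass gap

**Citation header (reproduction of PUBLISHED work).** J. Dimock, *Quantum electrodynamics on the 3-torus. II. The
renormalization group flow*, arXiv:math-ph/0407063 (2004) [Dimock2004QED3TorusII]: the one-step covariant average (5)
p.3 L67–72, the recursion (33) p.7 L45–52 (= (209) p.32), the gauge covariance (32) p.7 L41–44, and **Appendix A.2,
(212)–(213) p.33 L59–75, the chain of points p.33 L82 – p.34 L5, LEMMA 6 (214) p.34 L6–17 with its proof (215)–(217)
p.34 L18–75** (held arXiv-v1 text layer `paper:arxiv-math-ph_0407063`, `p.NN Lnn` = PDF page ∕ text-layer line); cube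
conventions of paper I, arXiv:math-ph/0210020 [Dimock2002QED3TorusI], (21) p.9.  Writer seat p11
(literature-prover-lit-balaban-p11-g23-0), YM LIT SWEEP item (c) D13 (row C13; zero weight for the YM-INPRINT tokens).
Companion of the tree's `QuantumLattice/FermionBlockRGComposition.lean` (App. A.2 LEMMA 5 (210)–(211), the Gaussian
composition law), whose scope note (iii) records LEMMA 6 (214) as not formalized — this file supplies it.

**The printed text.** (5) p.3 L67–72: *"For fermions this has the gauge covariant form
`(Q_{e_k}(A′_k)Ψ)(y) = L^{−3} Σ_{|x−y|≤L/2} exp(ie_kA′_k(Γ_{yx})) Ψ(x)`"* (p.4 L3: *"`Γ_{yx}` is a standard path from `x` to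
`y`"*).  (32)–(33) p.7 L41–52: *"For a scalar `λ` … `(Q̃_j(A + dλ))_μ(y) = (Q̃_jA)_μ(y) + λ(y) − λ(y + e_μ)` (32) so this
averaging is gauge covariant. … The multiple averaging operators `Q_k(a_{k−1}, …, a_0)` depend on fields `a_{k−1}, …, a_0`
all on `T^{−k}_{N+M−k}`. They are defined recursively by `Q_{k+1}(a_k, …, a_0) = σ_{L^{−1}} Q_{e_k}(Q̃_ka_{k,L}) Q_k(a_{k−1,L},
…, a_{0,L}) σ_L` (33) … An explicit expression is given in Appendix A."*  (212)–(213) p.33 L59–75: *"First for `k = 1` we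
consider `Q_1(a_0) = σ_L^{−1}Q_{e_0}(a_{0,L})σ_L` and compute it as `(Q_1(a_0)ψ)(y) = L^{−3}Σ_{|x−Ly|<L/2} exp(ie_0a_{0,L}(Γ_{Ly,x}))
ψ(x/L) = ∫_{|x−y|<1/2} exp(ie_0a_{0,L}(Γ_{Ly,Lx})) ψ(x) = ∫_{|x−y|<1/2} exp(ie_1a_0(Γ_{y,x})) ψ(x)` (212). Here we have used
`e_1 = L^{1/2}e_0` and `A_L(Γ_L) = L^{1/2}A(Γ)` (213)"*.  p.33 L82 – p.34 L5: *"Also given `y ∈ T⁰_{N+M−k}` and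
`x ∈ T^{−k}_{N+M−k}` with `|x − y| ≤ 1/2` we define a sequence of points `x_0 = x, x_1, …, x_{k−1}, x_k = y` where `x_j` is the
point in `T^{−(k−j)}_{N+M−k}` such that `|x − x_j| < L^{−(k−j)}/2`. Finally let `Γ_{x_{j+1},x_j}` be the standard contour in
`T^{−(k−j)}_{N+M−k}` taking `x_j` to `x_{j+1}`."*  **LEMMA 6** (p.34 L6–17):
*"`(Q_k(a_{k−1}, ⋯, a_0)ψ)(y) = ∫_{|x−y|<1/2} exp(ie_k Σ_{j=0}^{k−1} (Q̃_ja_j)(Γ_{x_{j+1},x_j})) ψ(x)` (214)"*.  Proof (p.34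
L18–75): *"By induction. We know it is true for `k = 1` and assuming it is true for `k` we compute `(Q_{k+1}(a_k, ⋯, a_0)ψ)(y′)
= L^{−3}∫_{|x−Ly′|<L/2} exp(ie_k(Q̃_ka_{k,L})(Γ_{Ly′,x_k})) exp(ie_k Σ_{j=0}^{k−1}(Q̃_ja_{j,L})(Γ_{x_{j+1},x_j})) ψ(x/L)` (215)
*Now make the change of variables `x = Lx′`. Then `x_j = Lx′_j` and we obtain … `= ∫_{|x′−y′|<1/2} exp(ie_k Σ_{j=0}^{k}
(Q̃_ja_{j,L})(Γ_{Lx′_{j+1},Lx′_j})) ψ(x′)` (216) with `x′_{k+1} = y′`. Now we use (213) and `e_{k+1} = L^{1/2}e_k` to write this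
as `(Q_{k+1}(a_k, ⋯, a_0)ψ)(y′) = ∫_{|x′−y′|<1/2} exp(ie_{k+1} Σ_{j=0}^{k} (Q̃_ja_j)(Γ_{x′_{j+1},x′_j})) ψ(x′)` (217) which is the
statement for `k + 1`."*

**What is formalized (all PROVED; no named facts, no `sorry`).**  FINE INDEX COORDINATES on `ℤ^ι` (`ι` a `Fintype` of
directions; the paper has `ι = Fin 3`), `L = 2a + 1` odd, reusing gen 22's `QED3TorusII.cube ∕ centre ∕ centreIter ∕
blockUpIter` (`QED3BlockingGeometry.lean`): all lattices `T^{−(k−j)}` are read inside the finest one, a point of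
`T^{−(k−j)}` being recorded by its level-`j` index, so that the printed chain is **`x_j = ν^j(x) = centreIter a j x`**
(`x_0 = x`, `x_{j+1}` = the centre of the `L`-cube containing `x_j`; *"`|x − x_j| < L^{−(k−j)}/2`"*) and the domain
`|x − y| < 1/2` of (214) is the `L^k`-cube `blockUpIter a k {y} = {x : ν^k(x) = y}` (`QED3TorusII.mem_blockUpIter`); the
scalings `σ_L` of (33)/(215)–(216) are then identity maps (as in `BlockAveragingComposition.lean`, reading (i)).  The
LINK PHASES are data: `θ j y x : ℝ` stands for `e_k(Q̃_ja_j)(Γ_{y,x})` (level-`j` step from `x = x_j` to `y = x_{j+1}`);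
what (213) and `e_{k+1} = L^{1/2}e_k` do in the printed proof is to rename these numbers after rescaling, which is
invisible here (declared reading).  Scalars: a field `𝕜` (`ℂ` for the phases), fields `ψ` with values in any `𝕜`-module
`M` (the Grassmann-valued `ψ` of the paper included).
* §1 `wavg a w ψ y = (L^{|ι|})^{−1} Σ_{x ∈ B(Ly)} w(y,x)•ψ(x)` — ONE STEP (5)/(212) with a general link weight `w(y,x) ∈ 𝕜`
  (for (5): `w(y,x) = exp(ie_kA′_k(Γ_{yx}))`); `wavgIter a w k` — the RECURSION (33)/(209), `Q_0 = id`,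
  `Q_{k+1} = Q(w_k) ∘ Q_k` (`wavgIter_one`: `Q_1 = Q(w_0)`; `eq212`: the case `k = 1` of (214) = (212)); `chainWeight a w k x = w_{k−1}(x_k,x_{k−1}) ⋯ w_0(x_1,x_0)` — the weight accumulated along the
  chain (`chainWeight_eq_prod`).
* §2 **`wavgIter_eq` — THE COMPOSITION LAW (the induction (215)–(217))**: `(Q_kψ)(y) = (L^{|ι|k})^{−1} Σ_{x : ν^k(x)=y}
  chainWeight_k(x)•ψ(x)`; the fibre decomposition `blockUpIter a (k+1) {y} = ⨆_{x₁ ∈ B(Ly)} blockUpIter a k {x₁}` behind it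
  (`sum_blockUpIter_succ`); `card_blockUpIter_singleton` (`#{x : ν^k(x) = y} = L^{|ι|k}`) and `wavgIter_const`
  (`Q_k c = c` when all weights are `1` on the chain: it is an average); `wavgIter_one_weight` (all `w ≡ 1`: the plain
  `k`-fold block average IS the block average over the `L^k`-cube — the boson statement `Q_k = Q^k` of
  `BlockAveragingComposition.lean`, here on CENTRED cubes).
* §3 **`lemma6` — (214) AS PRINTED** for phases `w_j(y,x) = exp(iθ_j(y,x))`:
  `(Q_kψ)(y) = (L^{|ι|k})^{−1} Σ_{x : ν^k(x)=y} exp(i Σ_{j=0}^{k−1} θ_j(x_{j+1},x_j))•ψ(x)` (`chainWeight_phase`: the product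
  of the link phases is the exponential of the summed phase, `Complex.exp_sum`).
* §4 **`lemma6_gauge` — gauge covariance of the composite** (the mechanism of (32): `∫_Γ dλ = λ(end) − λ(start)`): if the
  link phases transform as `θ′_j(y,x) = θ_j(y,x) + λ_{j+1}(y) − λ_j(x)` then the chain phase telescopes
  (`chainPhase_gauge`: `Σ_jθ′_j = Σ_jθ_j + λ_k(y) − λ_0(x)`) and `Q′_kψ = e^{iλ_k}·Q_k(e^{−iλ_0}ψ)`.

**Not here.** The averaging `Q̃_j` of gauge fields (31) and the contour integrals `a(Γ)` themselves (the phases are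
data); the torus; the Gaussian identities (210)–(211) (the tree's `FermionBlockRGComposition.lean`) and the boson
LEMMA 4 (206)–(208) (the tree's `GaussianSingleStep.lean` ∕ `BlockTransformComposition.lean`); (36) `Q_k(A) ≡ Q_k(A,…,A)`
is the special case `θ_j` all derived from one field and needs no separate statement.  No `d = 4` statement; nothing
about Bałaban's papers (their composite covariant averages, e.g. the tree's `Balaban1983to89.B2Eq39ConcreteForms.avgQIter`,
are composed as linear maps for the Higgs field; the explicit abelian chain formula (214) is specific to this file).

**v1.1 (append-only, same seat):** §5 «`Q_{e_k}(A)Q_{e_k}(−A)ᵀ = I`» ((211) p.33 L54; Bałaban–O'Carroll–Schor's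
`Q_kQ_k^* = I`) — `conjLift`∕`conjLiftIter` (the conjugate lift `Q(w̄)ᵀΦ`: `Φ(ν^k(x))` times the conjugate chain weight,
without the volume factor — the tree's `Qb` normalisation `Q·Q̄ = 1` of `FermionBlockRGComposition`) and `wavg_conjLift`,
`wavgIter_conjLiftIter` (`Q_k(w)(Q_k(w̄)ᵀΦ) = Φ` whenever `w·w̄ = 1` linkwise), `wavgIter_phase_conjLift` (the `U(1)` phases
`e^{±iθ}`).  No v1.0 declaration changed or removed.
-/

noncomputable section

namespace Literature.MathematicalPhysics.QuantumFieldTheory.Dimock2011to13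

namespace QED3CovariantAveraging

open Finset QED3TorusII

variable {ι : Type*} [Fintype ι] [DecidableEq ι]

/-! ## §0 Geometry: the `L^k`-cube `{x : ν^k(x) = y}` and its fibres -/

/-- `#B(c) = L^{|ι|}` for the centred `L`-cube, `L = 2a+1` («`L^{3}` sites»). [cite: Dimock2002QED3TorusI, (21) p.9 L38–42] -/
theorem card_cube (a : ℕ) (c : ι → ℤ) : #(cube a c) = (2 * a + 1) ^ Fintype.card ι := by
  have h : ∀ μ ∈ (univ : Finset ι), #(Icc (c μ - a) (c μ + a)) = 2 * a + 1 := by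
    intro μ _
    rw [Int.card_Icc]
    have : c μ + a + 1 - (c μ - a) = ((2 * a + 1 : ℕ) : ℤ) := by push_cast; ring
    rw [this, Int.toNat_natCast]
  unfold cube
  rw [Fintype.card_piFinset, prod_congr rfl h, prod_const, card_univ]

/-- **the fibre decomposition of the `L^{k+1}`-cube**: `x_{k+1} = y` iff `x_k ∈ B(Ly)`, i.e.
`{x : ν^{k+1}(x) = y} = ⨆_{x₁ ∈ B(Ly)} {x : ν^k(x) = x₁}` — the step *"`x_j = Lx′_j` … with `x′_{k+1} = y′`"* of (216): a sum
over the big cube is a sum over the last-but-one centre `x₁` and then over its fibre.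
[cite: Dimock2004QED3TorusII, App. A (215)–(216) p.34 L18–63] -/
theorem sum_blockUpIter_succ {β : Type*} [AddCommMonoid β] (a k : ℕ) (y : ι → ℤ) (f : (ι → ℤ) → β) :
    ∑ x ∈ blockUpIter a (k + 1) {y}, f x =
      ∑ x₁ ∈ cube a ((2 * a + 1 : ℤ) • y), ∑ x ∈ blockUpIter a k {x₁}, f x := by
  rw [← sum_fiberwise_of_maps_to (s := blockUpIter a (k + 1) {y}) (t := cube a ((2 * a + 1 : ℤ) • y))
    (g := centreIter a k) ?_]
  · refine sum_congr rfl fun x₁ hx₁ => sum_congr ?_ fun _ _ => rfl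
    ext x
    rw [mem_filter, mem_blockUpIter, mem_blockUpIter, mem_singleton, mem_singleton, centreIter_succ']
    rw [mem_cube_smul_iff] at hx₁
    constructor
    · rintro ⟨_, h⟩; exact h
    · intro h; exact ⟨by rw [h, hx₁], h⟩
  · intro x hx
    rw [mem_blockUpIter, mem_singleton, centreIter_succ'] at hx
    exact mem_cube_smul_iff.2 hx

/-- `#{x : ν^k(x) = y} = L^{|ι|k}` — the `L^k`-cube «`|x − y| < 1/2`» of (214) has `L^{3k}` fine sites (`∫_{|x−y|<1/2} = L^{−3k}Σ`).
[cite: Dimock2004QED3TorusII, App. A (214) p.34 L6–17; Dimock2002QED3TorusI, (21) p.9] -/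
theorem card_blockUpIter_singleton (a : ℕ) : ∀ (k : ℕ) (y : ι → ℤ),
    #(blockUpIter a k {y}) = ((2 * a + 1) ^ Fintype.card ι) ^ k
  | 0, y => by simp [blockUpIter]
  | k + 1, y => by
      have h : ∀ x₁ ∈ cube a ((2 * a + 1 : ℤ) • y),
          ∑ _x ∈ blockUpIter a k {x₁}, (1 : ℕ) = ((2 * a + 1) ^ Fintype.card ι) ^ k := by
        intro x₁ _
        rw [← card_eq_sum_ones, card_blockUpIter_singleton a k x₁]
      rw [card_eq_sum_ones, sum_blockUpIter_succ, sum_congr rfl h, sum_const, smul_eq_mul, card_cube]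
      ring

/-! ## §1 One step (5)/(212), the recursion (33)/(209), the accumulated chain weight -/

section Weighted

variable {𝕜 : Type*} [Field 𝕜] {M : Type*} [AddCommGroup M] [Module 𝕜 M]

/-- **ONE STEP, (5)/(212)**: `(Q(w)ψ)(y) = L^{−|ι|} Σ_{|x−Ly|<L/2} w(y,x)•ψ(x)` — the block average over the centred `L`-cube at
`Ly` with a link weight `w(y,x)` (for (5), `w(y,x) = exp(ie_kA′_k(Γ_{yx}))`, `Γ_{yx}` the standard path from `x` to `y`).
[cite: Dimock2004QED3TorusII, (5) p.3 L67–72; App. A (212) p.33 L59–73] -/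
def wavg (a : ℕ) (w : (ι → ℤ) → (ι → ℤ) → 𝕜) (ψ : (ι → ℤ) → M) (y : ι → ℤ) : M :=
  (((2 * a + 1 : 𝕜) ^ Fintype.card ι)⁻¹) • ∑ x ∈ cube a ((2 * a + 1 : ℤ) • y), w y x • ψ x

/-- unfolding `wavg`. [cite: Dimock2004QED3TorusII, (5) p.3 L67–72] -/
theorem wavg_def (a : ℕ) (w : (ι → ℤ) → (ι → ℤ) → 𝕜) (ψ : (ι → ℤ) → M) (y : ι → ℤ) :
    wavg a w ψ y = (((2 * a + 1 : 𝕜) ^ Fintype.card ι)⁻¹) • ∑ x ∈ cube a ((2 * a + 1 : ℤ) • y), w y x • ψ x :=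
  rfl

/-- **THE RECURSION (33)/(209)**: `Q_0 = id`, `Q_{k+1}(a_k, …, a_0) = Q_{e_k}(Q̃_ka_k) ∘ Q_k(a_{k−1}, …, a_0)` (the scalings
`σ_L^{±1}` being identities in index coordinates); `w j` is the link weight of the step from level `j` to level `j+1`.
[cite: Dimock2004QED3TorusII, (33) p.7 L45–52; App. A (209) p.32] -/
def wavgIter (a : ℕ) (w : ℕ → (ι → ℤ) → (ι → ℤ) → 𝕜) : ℕ → ((ι → ℤ) → M) → (ι → ℤ) → M
  | 0, ψ => ψ
  | k + 1, ψ => wavg a (w k) (wavgIter a w k ψ)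

/-- `Q_0 = id`. [cite: Dimock2004QED3TorusII, App. A (209) p.32 («Q_0 = id»)] -/
theorem wavgIter_zero (a : ℕ) (w : ℕ → (ι → ℤ) → (ι → ℤ) → 𝕜) (ψ : (ι → ℤ) → M) : wavgIter a w 0 ψ = ψ := rfl

/-- `Q_{k+1} = Q(w_k) ∘ Q_k`. [cite: Dimock2004QED3TorusII, (33) p.7 L45–52; App. A (209) p.32] -/
theorem wavgIter_succ (a : ℕ) (w : ℕ → (ι → ℤ) → (ι → ℤ) → 𝕜) (k : ℕ) (ψ : (ι → ℤ) → M) :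
    wavgIter a w (k + 1) ψ = wavg a (w k) (wavgIter a w k ψ) := rfl

/-- `Q_1 = Q(w_0)` — the base case «We know it is true for `k = 1`» ((212)).
[cite: Dimock2004QED3TorusII, App. A (212) p.33 L59–73, proof of Lemma 6 p.34 L18] -/
theorem wavgIter_one (a : ℕ) (w : ℕ → (ι → ℤ) → (ι → ℤ) → 𝕜) (ψ : (ι → ℤ) → M) :
    wavgIter a w 1 ψ = wavg a (w 0) ψ := rfl

/-- **the weight accumulated along the chain** `x = x_0, x_1 = ν(x_0), …, x_k`: `W_0 = 1`,
`W_{k+1}(x) = w_k(x_{k+1}, x_k)·W_k(x)` (for phases: the product of the link phases `exp(ie(Q̃_ja_j)(Γ_{x_{j+1},x_j}))`).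
[cite: Dimock2004QED3TorusII, App. A (214)–(216) p.34 L6–63] -/
def chainWeight (a : ℕ) (w : ℕ → (ι → ℤ) → (ι → ℤ) → 𝕜) : ℕ → (ι → ℤ) → 𝕜
  | 0, _ => 1
  | k + 1, x => w k (centreIter a (k + 1) x) (centreIter a k x) * chainWeight a w k x

omit [Fintype ι] [DecidableEq ι] in
/-- the chain weight is the product of the link weights `w_j(x_{j+1}, x_j)`, `j < k`.
[cite: Dimock2004QED3TorusII, App. A (214) p.34 L6–17] -/
theorem chainWeight_eq_prod (a : ℕ) (w : ℕ → (ι → ℤ) → (ι → ℤ) → 𝕜) : ∀ (k : ℕ) (x : ι → ℤ),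
    chainWeight a w k x = ∏ j ∈ range k, w j (centreIter a (j + 1) x) (centreIter a j x)
  | 0, _ => by simp [chainWeight]
  | k + 1, x => by rw [chainWeight, prod_range_succ, chainWeight_eq_prod a w k x, mul_comm]

/-! ## §2 The composition law — the induction (215)–(217) -/

/-- **THE COMPOSITION LAW (the induction (215)–(217) of LEMMA 6, for general link weights)**: the composite of `k` weighted
block averagings is ONE weighted average over the `L^k`-cube,
`(Q_kψ)(y) = (L^{|ι|k})^{−1} Σ_{x : ν^k(x) = y} W_k(x)•ψ(x)`, `W_k(x) = w_{k−1}(x_k,x_{k−1})⋯w_0(x_1,x_0)`.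
[cite: Dimock2004QED3TorusII, App. A Lemma 6 (214) p.34 L6–17, proof (215)–(217) p.34 L18–75] -/
theorem wavgIter_eq (a : ℕ) (w : ℕ → (ι → ℤ) → (ι → ℤ) → 𝕜) : ∀ (k : ℕ) (ψ : (ι → ℤ) → M) (y : ι → ℤ),
    wavgIter a w k ψ y =
      ((((2 * a + 1 : 𝕜) ^ Fintype.card ι) ^ k)⁻¹) • ∑ x ∈ blockUpIter a k {y}, chainWeight a w k x • ψ x
  | 0, ψ, y => by simp [wavgIter, chainWeight, blockUpIter]
  | k + 1, ψ, y => by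
      rw [wavgIter_succ, wavg_def, sum_blockUpIter_succ]
      -- inner values by the induction hypothesis
      have hin : ∀ x₁ ∈ cube a ((2 * a + 1 : ℤ) • y),
          w k y x₁ • wavgIter a w k ψ x₁ =
            ((((2 * a + 1 : 𝕜) ^ Fintype.card ι) ^ k)⁻¹) •
              ∑ x ∈ blockUpIter a k {x₁}, (w k y x₁ * chainWeight a w k x) • ψ x := by
        intro x₁ _
        rw [wavgIter_eq a w k ψ x₁, smul_comm, smul_sum, smul_sum, smul_sum]
        refine sum_congr rfl fun x _ => ?_
        rw [smul_smul, smul_smul, smul_smul, mul_assoc]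
      rw [sum_congr rfl hin, ← smul_sum, smul_smul, pow_succ, mul_inv,
        mul_comm ((((2 * a + 1 : 𝕜) ^ Fintype.card ι) ^ k)⁻¹)]
      congr 1
      refine sum_congr rfl fun x₁ hx₁ => sum_congr rfl fun x hx => ?_
      rw [mem_blockUpIter, mem_singleton] at hx
      rw [mem_cube_smul_iff] at hx₁
      simp only [chainWeight, centreIter_succ', hx, hx₁]

/-- **`Q_k c = c`-type normalisation**: with all link weights equal to `1` ALONG THE CHAIN the composite of a constant field
is the constant — the composite is an average over the `L^{|ι|k}` sites of the big cube.
[cite: Dimock2004QED3TorusII, App. A (214) p.34 L6–17; (12) p.5 («Q_0 = id and Q_{k+1} = σ_{L^{−1}}QQ_kσ_L»)] -/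
theorem wavgIter_const (a k : ℕ) (w : ℕ → (ι → ℤ) → (ι → ℤ) → 𝕜) (hw : ∀ j y x, w j y x = 1) (m : M) (y : ι → ℤ)
    (hchar : ((2 * a + 1 : 𝕜) ^ Fintype.card ι) ^ k ≠ 0) :
    wavgIter a w k (fun _ => m) y = m := by
  rw [wavgIter_eq]
  have hW : ∀ x, chainWeight a w k x = 1 := by
    intro x
    rw [chainWeight_eq_prod]
    exact prod_eq_one fun j _ => hw _ _ _
  simp only [hW, one_smul, sum_const, card_blockUpIter_singleton]
  rw [← Nat.cast_smul_eq_nsmul 𝕜, smul_smul]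
  push_cast
  rw [inv_mul_cancel₀ hchar, one_smul]

/-- **all weights `1`: the plain `k`-fold block average is the block average over the `L^k`-cube** — the boson statement
*"`Q_k = Q^k` … averaging over cubes with `L^k` on a side"* of Dimock's series, here on the CENTRED cubes of paper I (21)
(the tree's `BlockAveragingComposition.qavg_iterate` is the corner-anchored version).
[cite: Dimock2004QED3TorusII, (12) p.5; App. A (205) p.32] -/
theorem wavgIter_one_weight (a k : ℕ) (ψ : (ι → ℤ) → M) (y : ι → ℤ) :
    wavgIter a (fun _ _ _ => (1 : 𝕜)) k ψ y =
      ((((2 * a + 1 : 𝕜) ^ Fintype.card ι) ^ k)⁻¹) • ∑ x ∈ blockUpIter a k {y}, ψ x := by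
  rw [wavgIter_eq]
  congr 1
  refine sum_congr rfl fun x _ => ?_
  have h1 : chainWeight a (fun _ _ _ => (1 : 𝕜)) k x = 1 := by
    rw [chainWeight_eq_prod]
    exact prod_eq_one fun _ _ => rfl
  rw [h1, one_smul]

end Weighted

/-! ## §3 LEMMA 6 (214): abelian phases -/

section Phases

variable {M : Type*} [AddCommGroup M] [Module ℂ M]

/-- the `U(1)` link weight `exp(iθ_j(y,x))` of the phase datum `θ` (`θ_j(y,x)` = `e_k(Q̃_ja_j)(Γ_{y,x})`).
[cite: Dimock2004QED3TorusII, (5) p.3 L67–72; App. A (212) p.33 L59–73] -/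
def phaseWeight (θ : ℕ → (ι → ℤ) → (ι → ℤ) → ℝ) : ℕ → (ι → ℤ) → (ι → ℤ) → ℂ :=
  fun j y x => Complex.exp (Complex.I * θ j y x)

/-- the summed phase along the chain, `Σ_{j=0}^{k−1} θ_j(x_{j+1}, x_j)` — the exponent of (214).
[cite: Dimock2004QED3TorusII, App. A (214) p.34 L6–17] -/
def chainPhase (a : ℕ) (θ : ℕ → (ι → ℤ) → (ι → ℤ) → ℝ) (k : ℕ) (x : ι → ℤ) : ℝ :=
  ∑ j ∈ range k, θ j (centreIter a (j + 1) x) (centreIter a j x)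

omit [Fintype ι] [DecidableEq ι] in
/-- the product of the link phases along the chain is the exponential of the summed phase.
[cite: Dimock2004QED3TorusII, App. A (215)–(216) p.34 L18–63] -/
theorem chainWeight_phase (a : ℕ) (θ : ℕ → (ι → ℤ) → (ι → ℤ) → ℝ) (k : ℕ) (x : ι → ℤ) :
    chainWeight a (phaseWeight θ) k x = Complex.exp (Complex.I * chainPhase a θ k x) := by
  rw [chainWeight_eq_prod, chainPhase]
  simp only [phaseWeight]
  rw [← Complex.exp_sum]
  congr 1
  push_cast
  rw [mul_sum]

/-- **(212), the case `k = 1`**: `(Q_1(a_0)ψ)(y) = ∫_{|x−y|<1/2} exp(ie_1a_0(Γ_{y,x})) ψ(x)`, i.e. in index coordinates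
`(Q_1ψ)(y) = L^{−|ι|} Σ_{|x−Ly|<L/2} exp(iθ_0(y,x))•ψ(x)`. [cite: Dimock2004QED3TorusII, App. A (212) p.33 L59–73] -/
theorem eq212 (a : ℕ) (θ : ℕ → (ι → ℤ) → (ι → ℤ) → ℝ) (ψ : (ι → ℤ) → M) (y : ι → ℤ) :
    wavgIter a (phaseWeight θ) 1 ψ y =
      (((2 * a + 1 : ℂ) ^ Fintype.card ι)⁻¹) •
        ∑ x ∈ cube a ((2 * a + 1 : ℤ) • y), Complex.exp (Complex.I * θ 0 y x) • ψ x := by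
  rw [wavgIter_one, wavg_def]
  rfl

/-- **LEMMA 6 (214)**: *"`(Q_k(a_{k−1}, ⋯, a_0)ψ)(y) = ∫_{|x−y|<1/2} exp(ie_k Σ_{j=0}^{k−1} (Q̃_ja_j)(Γ_{x_{j+1},x_j})) ψ(x)`"* — in
index coordinates: `(Q_kψ)(y) = (L^{|ι|k})^{−1} Σ_{x : ν^k(x)=y} exp(i Σ_{j<k} θ_j(x_{j+1},x_j))•ψ(x)` for the composite
`Q_k = Q(θ_{k−1}) ∘ ⋯ ∘ Q(θ_0)` of the one-step covariant averages with link phases `θ_j`.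
[cite: Dimock2004QED3TorusII, App. A Lemma 6 (214) p.34 L6–17, proof (215)–(217) p.34 L18–75] -/
theorem lemma6 (a : ℕ) (θ : ℕ → (ι → ℤ) → (ι → ℤ) → ℝ) (k : ℕ) (ψ : (ι → ℤ) → M) (y : ι → ℤ) :
    wavgIter a (phaseWeight θ) k ψ y =
      ((((2 * a + 1 : ℂ) ^ Fintype.card ι) ^ k)⁻¹) •
        ∑ x ∈ blockUpIter a k {y}, Complex.exp (Complex.I * chainPhase a θ k x) • ψ x := by
  rw [wavgIter_eq]
  simp_rw [chainWeight_phase]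

/-! ## §4 Gauge covariance of the composite -/

omit [Fintype ι] [DecidableEq ι] in
/-- **the chain phase telescopes under a gauge transformation**: if `θ′_j(y,x) = θ_j(y,x) + λ_{j+1}(y) − λ_j(x)` (the
transformation of `e(Q̃_ja_j)(Γ_{y,x})` under `a_j ↦ a_j + dλ`, by the mechanism of (32): the integral of `dλ` along a
contour from `x` to `y` is `λ(y) − λ(x)`), then `Σ_{j<k}θ′_j(x_{j+1},x_j) = Σ_{j<k}θ_j(x_{j+1},x_j) + λ_k(x_k) − λ_0(x_0)`.
[cite: Dimock2004QED3TorusII, (32) p.7 L41–44 («so this averaging is gauge covariant»); App. A (214) p.34 L6–17] -/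
theorem chainPhase_gauge (a : ℕ) (θ θ' : ℕ → (ι → ℤ) → (ι → ℤ) → ℝ) (lam : ℕ → (ι → ℤ) → ℝ)
    (hθ : ∀ j y x, θ' j y x = θ j y x + lam (j + 1) y - lam j x) (k : ℕ) (x : ι → ℤ) :
    chainPhase a θ' k x = chainPhase a θ k x + lam k (centreIter a k x) - lam 0 x := by
  simp only [chainPhase, hθ, sum_add_distrib, sum_sub_distrib]
  have htel := sum_range_sub (fun j => lam j (centreIter a j x)) k
  have h0 : centreIter a 0 x = x := rfl
  rw [sum_sub_distrib, h0] at htel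
  linarith

/-- **gauge covariance of the composite averaging `Q_k`**: with `θ′` the gauge transform of `θ` by `λ` as in
`chainPhase_gauge`, `(Q′_kψ)(y) = e^{iλ_k(y)}·(Q_k(e^{−iλ_0}ψ))(y)`.
[cite: Dimock2004QED3TorusII, (32) p.7 L41–44; App. A Lemma 6 (214) p.34 L6–17] -/
theorem lemma6_gauge (a : ℕ) (θ θ' : ℕ → (ι → ℤ) → (ι → ℤ) → ℝ) (lam : ℕ → (ι → ℤ) → ℝ)
    (hθ : ∀ j y x, θ' j y x = θ j y x + lam (j + 1) y - lam j x) (k : ℕ) (ψ : (ι → ℤ) → M) (y : ι → ℤ) :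
    wavgIter a (phaseWeight θ') k ψ y =
      Complex.exp (Complex.I * lam k y) •
        wavgIter a (phaseWeight θ) k (fun x => Complex.exp (-(Complex.I * lam 0 x)) • ψ x) y := by
  rw [lemma6, lemma6,
    smul_comm (Complex.exp (Complex.I * lam k y)) ((((2 * a + 1 : ℂ) ^ Fintype.card ι) ^ k)⁻¹)]
  congr 1
  rw [smul_sum]
  refine sum_congr rfl fun x hx => ?_
  rw [mem_blockUpIter, mem_singleton] at hx
  rw [chainPhase_gauge a θ θ' lam hθ k x, hx, smul_smul, smul_smul, ← Complex.exp_add, ← Complex.exp_add]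
  congr 1
  push_cast
  ring

end Phases

/-! ## §5 (v1.1) «`Q_{e_k}(A)Q_{e_k}(−A)ᵀ = I`» — the covariant average inverts the conjugate lift -/

section Lift

variable {𝕜 : Type*} [Field 𝕜] {M : Type*} [AddCommGroup M] [Module 𝕜 M]

/-- **the conjugate lift `Q(w̄)ᵀΦ`** of a coarse field `Φ` to the fine lattice: constant `Φ(ν(x))` on each `L`-cube times the
link weight `w̄(ν(x), x)` of the transposed averaging (for (5): `w̄ = exp(−ie_kA(Γ_{yx}))`, the weight of `Q_{e_k}(−A)`; the
volume factor `L^{−|ι|}` of `Q` is NOT repeated in the lift — BOS's `Q⁺`, the tree's `Qb` of `FermionBlockRGComposition`).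
[cite: Dimock2004QED3TorusII, App. A (211) p.33 L54 («Here we have used Q_{e_k}(A)Q_{e_k}(−A)ᵀ = I»); (6) p.4 L3–7] -/
def conjLift (a : ℕ) (wb : (ι → ℤ) → (ι → ℤ) → 𝕜) (Φ : (ι → ℤ) → M) (x : ι → ℤ) : M :=
  wb (centre a x) x • Φ (centre a x)

/-- **«`Q_{e_k}(A)Q_{e_k}(−A)ᵀ = I`» (one step)**: if `w(y,x)·w̄(y,x) = 1` on the cube at `y` (phases: `e^{iθ}e^{−iθ} = 1`) then
averaging the conjugate lift returns the coarse field, `Q(w)(Q(w̄)ᵀΦ)(y) = Φ(y)` — Bałaban–O'Carroll–Schor's `Q_kQ_k^* = I`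
in the tree's normalisation `Q·Q̄ = 1` of `FermionBlockRGComposition`.
[cite: Dimock2004QED3TorusII, App. A (211) p.33 L54; BalabanOcarrollSchor1989, §II p.237 L15 («Q_kQ_k^* = I»)] -/
theorem wavg_conjLift (a : ℕ) (w wb : (ι → ℤ) → (ι → ℤ) → 𝕜) (Φ : (ι → ℤ) → M) (y : ι → ℤ)
    (hw : ∀ x ∈ cube a ((2 * a + 1 : ℤ) • y), w y x * wb y x = 1)
    (hchar : ((2 * a + 1 : 𝕜) ^ Fintype.card ι) ≠ 0) :
    wavg a w (conjLift a wb Φ) y = Φ y := by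
  rw [wavg_def]
  have h1 : ∀ x ∈ cube a ((2 * a + 1 : ℤ) • y), w y x • conjLift a wb Φ x = Φ y := by
    intro x hx
    rw [conjLift, mem_cube_smul_iff.1 hx, smul_smul, hw x hx, one_smul]
  rw [sum_congr rfl h1, sum_const, card_cube, ← Nat.cast_smul_eq_nsmul 𝕜, smul_smul]
  push_cast
  rw [inv_mul_cancel₀ hchar, one_smul]

/-- **the `k`-fold conjugate lift `Q_k(−a_{k−1}, …, −a_0)ᵀΦ`**: `Φ(ν^k(x))` times the accumulated conjugate weight along the
chain. [cite: Dimock2004QED3TorusII, App. A (210)–(211) p.33 L1–58, (214) p.34 L6–17] -/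
def conjLiftIter (a : ℕ) (wb : ℕ → (ι → ℤ) → (ι → ℤ) → 𝕜) (k : ℕ) (Φ : (ι → ℤ) → M) (x : ι → ℤ) : M :=
  chainWeight a wb k x • Φ (centreIter a k x)

/-- **«`Q_kQ_k^* = I`» for the composite**: if every link weight satisfies `w_j(y,x)·w̄_j(y,x) = 1` then
`Q_k(w)(Q_k(w̄)ᵀΦ) = Φ` (from the composition law `wavgIter_eq`: the chain weights multiply to `1` along every chain).
[cite: Dimock2004QED3TorusII, App. A (211) p.33 L54, Lemma 6 (214) p.34 L6–17; BalabanOcarrollSchor1989, §II Lemma II.1 p.237] -/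
theorem wavgIter_conjLiftIter (a : ℕ) (w wb : ℕ → (ι → ℤ) → (ι → ℤ) → 𝕜) (hw : ∀ j y x, w j y x * wb j y x = 1)
    (k : ℕ) (Φ : (ι → ℤ) → M) (y : ι → ℤ) (hchar : ((2 * a + 1 : 𝕜) ^ Fintype.card ι) ^ k ≠ 0) :
    wavgIter a w k (conjLiftIter a wb k Φ) y = Φ y := by
  rw [wavgIter_eq]
  have hW : ∀ x, chainWeight a w k x * chainWeight a wb k x = 1 := by
    intro x
    rw [chainWeight_eq_prod, chainWeight_eq_prod, ← prod_mul_distrib]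
    exact prod_eq_one fun j _ => hw _ _ _
  have h1 : ∀ x ∈ blockUpIter a k {y}, chainWeight a w k x • conjLiftIter a wb k Φ x = Φ y := by
    intro x hx
    rw [mem_blockUpIter, mem_singleton] at hx
    rw [conjLiftIter, hx, smul_smul, hW x, one_smul]
  rw [sum_congr rfl h1, sum_const, card_blockUpIter_singleton, ← Nat.cast_smul_eq_nsmul 𝕜, smul_smul]
  push_cast
  rw [inv_mul_cancel₀ hchar, one_smul]

/-- the `U(1)` instance: for phases `w = e^{iθ}`, `w̄ = e^{−iθ}` (the weights of `Q_{e_k}(A)` and `Q_{e_k}(−A)`),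
`Q(θ)(Q(−θ)ᵀΦ) = Φ` — literally «`Q_{e_k}(A)Q_{e_k}(−A)ᵀ = I`». [cite: Dimock2004QED3TorusII, App. A (211) p.33 L54; (5)–(6) p.3 L67 – p.4 L7] -/
theorem wavgIter_phase_conjLift {M : Type*} [AddCommGroup M] [Module ℂ M] (a : ℕ) (θ : ℕ → (ι → ℤ) → (ι → ℤ) → ℝ)
    (k : ℕ) (Φ : (ι → ℤ) → M) (y : ι → ℤ) :
    wavgIter a (phaseWeight θ) k (conjLiftIter a (phaseWeight fun j y x => -θ j y x) k Φ) y = Φ y := by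
  refine wavgIter_conjLiftIter a _ _ (fun j y' x => ?_) k Φ y ?_
  · simp only [phaseWeight]
    rw [← Complex.exp_add]
    push_cast
    rw [mul_neg, add_neg_cancel, Complex.exp_zero]
  · apply pow_ne_zero
    apply pow_ne_zero
    exact_mod_cast (show (2 * a + 1 : ℕ) ≠ 0 by omega)

end Lift

end QED3CovariantAveraging

end Literature.MathematicalPhysics.QuantumFieldTheory.Dimock2011to13
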